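import Mathlib.AlgebraicGeometry.ResidueField
import Mathlib.AlgebraicGeometry.AffineSpace
import Mathlib.AlgebraicGeometry.Morphisms.Proper
import Mathlib.AlgebraicGeometry.Pullbacks
import Mathlib.Analysis.Complex.Basic
import Mathlib.Analysis.Normed.Field.Basic
import Mathlib.Topology.ContinuousMap.Basic
import Summits.Ventures.HodgeRepro2.HostAPI.Carriers.AlgebraicGeometry.Motives.Varieties
import Summits.Ventures.HodgeRepro2.HostAPI.Util.ForallBinderLint
open HostAPI.Carriers

universe u

open CategoryTheory AlgebraicGeometry MonoidalCategory Topology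

noncomputable section

namespace HostAPI.Carriers.AlgebraicGeometry.Motives

variable {k : Type u} [Field k]

abbrev AlgPoints (X : SchemeOver k) (L : Type u) [Field L] [Algebra k L] : Type u :=
  specOver k L ⟶ X

namespace AlgPoints

variable {X Y Z : SchemeOver k} {L : Type u} [Field L] [Algebra k L]

abbrev mk (P : Spec (.of L) ⟶ X.left)
    (w : P ≫ X.hom = Spec.map (CommRingCat.ofHom (algebraMap k L))) : AlgPoints X L :=
  Over.homMk P w

abbrev toSpecHom (P : AlgPoints X L) : Spec (.of L) ⟶ X.left := P.left

def pt (P : AlgPoints X L) : X.left := (X.left.SpecToEquivOfField L P.left).1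

def resHom (P : AlgPoints X L) : X.left.residueField P.pt ⟶ .of L :=
  (X.left.SpecToEquivOfField L P.left).2

def eval (P : AlgPoints X L) (U : X.left.Opens) (h : P.pt ∈ U) (f : Γ(X.left, U)) : L :=
  P.resHom (X.left.evaluation U P.pt h f)

def basicSet (U : X.left.Opens) (f : Γ(X.left, U)) (V : Set L) : Set (AlgPoints X L) :=
  {P | ∃ h : P.pt ∈ U, P.eval U h f ∈ V}

instance instTopologicalSpace [TopologicalSpace L] : TopologicalSpace (AlgPoints X L) :=
  TopologicalSpace.generateFrom
    {S | ∃ (U : X.left.Opens) (f : Γ(X.left, U)) (V : Set L), IsOpen V ∧ S = basicSet U f V}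

theorem isOpen_basicSet [TopologicalSpace L] (U : X.left.Opens) (f : Γ(X.left, U)) {V : Set L}
    (hV : IsOpen V) : IsOpen (basicSet U f V : Set (AlgPoints X L)) :=
  TopologicalSpace.isOpen_generateFrom_of_mem ⟨U, f, V, hV, rfl⟩

def map (φ : X ⟶ Y) (P : AlgPoints X L) : AlgPoints Y L := P ≫ φ

theorem map_apply (φ : X ⟶ Y) (P : AlgPoints X L) : map φ P = P ≫ φ := rfl

@[simp]
theorem map_id_apply (P : AlgPoints X L) : map (𝟙 X) P = P := by
  simp [map]

theorem map_id : map (𝟙 X) = (id : AlgPoints X L → AlgPoints X L) :=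
  funext map_id_apply

@[simp]
theorem map_comp_apply (φ : X ⟶ Y) (ψ : Y ⟶ Z) (P : AlgPoints X L) :
    map (φ ≫ ψ) P = map ψ (map φ P) := by
  simp [map]

theorem map_comp (φ : X ⟶ Y) (ψ : Y ⟶ Z) :
    map (L := L) (φ ≫ ψ) = map ψ ∘ map φ :=
  funext (map_comp_apply φ ψ)

@[simp]
theorem pt_map (φ : X ⟶ Y) (P : AlgPoints X L) : (map φ P).pt = φ.left (P.pt) := rfl

theorem resHom_map (φ : X ⟶ Y) (P : AlgPoints X L) :
    (map φ P).resHom = φ.left.residueFieldMap P.pt ≫ P.resHom :=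
  Scheme.descResidueField_stalkClosedPointTo_comp φ.left P.left

theorem eval_map (φ : X ⟶ Y) (P : AlgPoints X L) (U : Y.left.Opens) (h : (map φ P).pt ∈ U)
    (f : Γ(Y.left, U)) :
    (map φ P).eval U h f = P.eval (φ.left ⁻¹ᵁ U) h (φ.left.app U f) := by
  simp only [eval, resHom_map]
  change (φ.left.residueFieldMap P.pt ≫ P.resHom) (Y.left.evaluation U (φ.left P.pt) h f) = _
  rw [CategoryTheory.comp_apply, Scheme.evaluation_naturality_apply]

theorem preimage_map_basicSet (φ : X ⟶ Y) (U : Y.left.Opens) (f : Γ(Y.left, U)) (V : Set L) :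
    map φ ⁻¹' (basicSet U f V : Set (AlgPoints Y L)) =
      basicSet (φ.left ⁻¹ᵁ U) (φ.left.app U f) V := by
  ext P
  simp only [Set.mem_preimage, basicSet, Set.mem_setOf_eq, eval_map]
  rfl

theorem continuous_map [TopologicalSpace L] (φ : X ⟶ Y) :
    Continuous (map φ : AlgPoints X L → AlgPoints Y L) := by
  refine continuous_generateFrom_iff.mpr ?_
  rintro _ ⟨U, f, V, hV, rfl⟩
  rw [preimage_map_basicSet]
  exact isOpen_basicSet _ _ hV

def mapContinuous [TopologicalSpace L] (φ : X ⟶ Y) : C(AlgPoints X L, AlgPoints Y L) :=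
  ⟨map φ, continuous_map φ⟩

@[simp]
theorem mapContinuous_apply [TopologicalSpace L] (φ : X ⟶ Y) (P : AlgPoints X L) :
    mapContinuous φ P = map φ P := rfl

def prodEquiv : AlgPoints (X ⊗ Y) L ≃ AlgPoints X L × AlgPoints Y L where
  toFun P := (P ≫ CartesianMonoidalCategory.fst X Y, P ≫ CartesianMonoidalCategory.snd X Y)
  invFun Q := CartesianMonoidalCategory.lift Q.1 Q.2
  left_inv P := by simp
  right_inv Q := by simp

@[simp]
theorem prodEquiv_apply_fst (P : AlgPoints (X ⊗ Y) L) :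
    (prodEquiv P).1 = map (CartesianMonoidalCategory.fst X Y) P := rfl

@[simp]
theorem prodEquiv_apply_snd (P : AlgPoints (X ⊗ Y) L) :
    (prodEquiv P).2 = map (CartesianMonoidalCategory.snd X Y) P := rfl

@[simp]
theorem prodEquiv_symm_apply (P : AlgPoints X L) (Q : AlgPoints Y L) :
    prodEquiv.symm (P, Q) = CartesianMonoidalCategory.lift P Q := rfl

def isHomeomorph_prodEquiv : Prop :=
  ∀ [TopologicalSpace L] [IsTopologicalDivisionRing L] [T2Space L],
    IsHomeomorph (prodEquiv : AlgPoints (X ⊗ Y) L ≃ AlgPoints X L × AlgPoints Y L)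

def specMap (σ : L ≃ₐ[k] L) : specOver k L ⟶ specOver k L :=
  Over.homMk (Spec.map (CommRingCat.ofHom (σ : L →+* L))) (by
    change Spec.map _ ≫ Spec.map _ = Spec.map _
    rw [← Spec.map_comp, ← CommRingCat.ofHom_comp]
    congr 2
    exact RingHom.ext σ.commutes)

@[simp]
theorem specMap_left (σ : L ≃ₐ[k] L) :
    (specMap σ).left = Spec.map (CommRingCat.ofHom (σ : L →+* L)) := rfl

@[simp]
theorem specMap_one : specMap (1 : L ≃ₐ[k] L) = 𝟙 _ := by
  ext : 1
  have h1 : ((1 : L ≃ₐ[k] L) : L →+* L) = RingHom.id L := RingHom.ext fun _ => rfl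
  simp only [specMap, Over.homMk_left, Over.id_left, h1]
  change Spec.map (𝟙 (CommRingCat.of L)) = _
  rw [Spec.map_id]
  rfl

theorem specMap_mul (σ τ : L ≃ₐ[k] L) : specMap (σ * τ) = specMap σ ≫ specMap τ := by
  ext : 1
  have h1 : ((σ * τ : L ≃ₐ[k] L) : L →+* L) = (σ : L →+* L).comp τ := RingHom.ext fun _ => rfl
  simp only [specMap, Over.homMk_left, Over.comp_left, h1, CommRingCat.ofHom_comp, Spec.map_comp]
  rfl

instance instMulActionAlgEquiv : MulAction (L ≃ₐ[k] L) (AlgPoints X L) where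
  smul σ P := specMap σ ≫ P
  one_smul P := by change specMap 1 ≫ P = P; rw [specMap_one]; simp
  mul_smul σ τ P := by
    change specMap (σ * τ) ≫ P = specMap σ ≫ (specMap τ ≫ P); rw [specMap_mul]; simp

theorem smul_def (σ : L ≃ₐ[k] L) (P : AlgPoints X L) : σ • P = specMap σ ≫ P := rfl

@[simp]
theorem map_smul (φ : X ⟶ Y) (σ : L ≃ₐ[k] L) (P : AlgPoints X L) :
    map φ (σ • P) = σ • map φ P := by
  simp [smul_def, map]

theorem smul_left (σ : L ≃ₐ[k] L) (P : AlgPoints X L) :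
    (σ • P).left = Spec.map (CommRingCat.ofHom (σ : L →+* L)) ≫ P.left := rfl

theorem specToEquivOfField_smul (σ : L ≃ₐ[k] L) (P : AlgPoints X L) :
    X.left.SpecToEquivOfField L (σ • P).left =
      ⟨P.pt, P.resHom ≫ CommRingCat.ofHom (σ : L →+* L)⟩ := by
  apply (X.left.SpecToEquivOfField L).symm.injective
  rw [Equiv.symm_apply_apply, smul_left]
  simp only [Scheme.SpecToEquivOfField_symm_apply, Spec.map_comp, Category.assoc]
  congr 1
  exact ((X.left.SpecToEquivOfField L).symm_apply_apply P.left).symm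

@[simp]
theorem pt_smul (σ : L ≃ₐ[k] L) (P : AlgPoints X L) : (σ • P).pt = P.pt :=
  (Scheme.SpecToEquivOfField_eq_iff.mp (specToEquivOfField_smul σ P)).1

private theorem residueFieldCongr_evaluation {X : Scheme.{u}} (U : X.Opens) {x y : X}
    (e : x = y) (h : x ∈ U) (f : Γ(X, U)) :
    (X.residueFieldCongr e).hom (X.evaluation U x h f) = X.evaluation U y (e ▸ h) f := by
  subst e
  rfl

theorem eval_smul (σ : L ≃ₐ[k] L) (P : AlgPoints X L) (U : X.left.Opens) (h : (σ • P).pt ∈ U)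
    (f : Γ(X.left, U)) :
    (σ • P).eval U h f = σ (P.eval U ((pt_smul σ P) ▸ h) f) := by
  obtain ⟨e, he⟩ := Scheme.SpecToEquivOfField_eq_iff.mp (specToEquivOfField_smul σ P)
  change (X.left.SpecToEquivOfField L (σ • P).left).2 _ = _
  rw [he, CategoryTheory.comp_apply, CategoryTheory.comp_apply]
  change σ (P.resHom _) = σ (P.resHom _)
  congr 2
  exact residueFieldCongr_evaluation U e h f

theorem preimage_smul_basicSet (σ : L ≃ₐ[k] L) (U : X.left.Opens) (f : Γ(X.left, U))
    (V : Set L) :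
    (fun P : AlgPoints X L => σ • P) ⁻¹' basicSet U f V = basicSet U f (σ ⁻¹' V) := by
  ext P
  simp only [Set.mem_preimage, basicSet, Set.mem_setOf_eq, eval_smul]
  constructor
  · rintro ⟨h, hV⟩
    exact ⟨(pt_smul σ P) ▸ h, hV⟩
  · rintro ⟨h, hV⟩
    exact ⟨(pt_smul σ P).symm ▸ h, hV⟩

theorem continuous_smul_algEquiv [TopologicalSpace L] (σ : L ≃ₐ[k] L) (hσ : Continuous σ) :
    Continuous (fun P : AlgPoints X L => σ • P) := by
  refine continuous_generateFrom_iff.mpr ?_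
  rintro _ ⟨U, f, V, hV, rfl⟩
  rw [preimage_smul_basicSet]
  exact isOpen_basicSet _ _ (hV.preimage hσ)

end AlgPoints

section Topology

variable (X : SchemeOver k) (L : Type u)

def t2Space_algPoints : Prop :=
  ∀ [Field L] [Algebra k L] [TopologicalSpace L] [IsTopologicalDivisionRing L] [T2Space L] [IsSeparated X.hom],
    T2Space (AlgPoints X L)

def compactSpace_algPoints_of_isProper : Prop :=
  ∀ [NontriviallyNormedField L] [Algebra k L] [LocallyCompactSpace L] [IsProper X.hom],
    CompactSpace (AlgPoints X L)

def locallyCompactSpace_algPoints : Prop :=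
  ∀ [NontriviallyNormedField L] [Algebra k L] [LocallyCompactSpace L] [IsSeparated X.hom] [LocallyOfFiniteType X.hom],
    LocallyCompactSpace (AlgPoints X L)

def nonempty_algPoints_affineSpace_homeomorph : Prop :=
  ∀ [Field L] [Algebra k L] [TopologicalSpace L] [IsTopologicalDivisionRing L] [T2Space L] (σ : Type u) [Finite σ],
    Nonempty (AlgPoints (Over.mk (𝔸(σ; Spec (.of k)) ↘ Spec (.of k))) L ≃ₜ (σ → L))

end Topology

abbrev ComplexPoints {k : Type} [Field k] [Algebra k ℂ] (X : SchemeOver k) : Type :=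
  AlgPoints X ℂ

end HostAPI.Carriers.AlgebraicGeometry.Motives
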